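import Summits.Schanuel.Schanuel.Theorems.ZilberEacGraphLinearComplete
import Mathlib.FieldTheory.IsAlgClosed.Basic
import HarnessLib

/-!
# The equimodular class, XVIII: over polynomial graphs, a multiplicatively FREE surface of
# Mantova–Masser's case without dense exponential points has a fibre curve of `y₀`-degree `≥ 2`

HONEST FRAMING.  Cell `pub-schanuel` (Zilber's Exponential-Algebraic Closedness, case ladder;
host summit Schanuel), seat 2, gen 23.  File XVII left the alternative "fibre curve of `y₀`-degree
`≥ 2`, or `P₂ ∈ ℂ[y₀]`".  The second alternative is the constant fibre `y₀ = θ` (an irreducible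
univariate polynomial over `ℂ` is linear), on which the monomial `y₀` is constant: the surface is NOT
multiplicatively free (Zilber's freeness, `IsMulFree`).  Hence
**`mmCase_graphBase_residual_of_isMulFree`**: for a multiplicatively free `W` of the case over
`x₁ = p(x₀)`, `deg p ≥ 2`, without Zariski-dense exponential points, the fibre curve `P₂` has a monomial
of `y₀`-degree `≥ 2` — the free `y₀`-linear class over polynomial graphs is decided affirmatively, in
every degree.  Complete classes of instances of an OPEN question (PLMS 2024 §1 p. 5); EC(3,2) OPEN;
NOT Schanuel's conjecture (neither used nor implied; EAC ⇏ SC).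
-/

noncomputable section

open Filter Topology Set Complex MvPolynomial
open Literature.NumberTheory.Transcendental Literature.ModelTheory.Zilber
open Literature.ModelTheory.ExponentialFields

set_option linter.dupNamespace false

namespace Summit.Schanuel.Schanuel.Theorems

/-! ## Part A. A polynomial in `y₀` alone; irreducible ⟹ one root -/

section Univariate

variable (P : MvPolynomial (Fin 2) ℂ)

/-- A polynomial all of whose monomials have `x₀`-degree `0` is `q(X₁)` with
`q = Σ_v P_v X^{v₁}`. [folklore] -/
theorem eq_aeval_X_one_of_forall (h0 : ∀ v ∈ P.support, v 0 = 0) :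
    P = Polynomial.aeval (X 1 : MvPolynomial (Fin 2) ℂ)
      (∑ v ∈ P.support, Polynomial.monomial (v 1) (P.coeff v)) := by
  classical
  refine MvPolynomial.funext fun xs => ?_
  rw [mvEval_aeval_X, Polynomial.eval_finsetSum, MvPolynomial.eval_eq']
  refine Finset.sum_congr rfl fun v hv => ?_
  rw [Fin.prod_univ_two, h0 v hv, pow_zero, one_mul, Polynomial.eval_monomial]

/-- If `q(X_i)` is a unit of `ℂ[x₀, y₀]` then `q` is a unit of `ℂ[X]` (it has no root).
[folklore] -/
theorem isUnit_of_isUnit_aeval_X (q : Polynomial ℂ) (i : Fin 2)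
    (hu : IsUnit (Polynomial.aeval (X i : MvPolynomial (Fin 2) ℂ) q)) : IsUnit q := by
  rw [Polynomial.isUnit_iff_degree_eq_zero]
  by_contra hdeg
  have hq0 : q ≠ 0 := by
    rintro rfl
    rw [map_zero] at hu
    exact not_isUnit_zero hu
  have hpos : 0 < q.degree := by
    rcases lt_trichotomy q.degree 0 with h | h | h
    · exact absurd (Polynomial.degree_eq_bot.1 (by
        rcases Nat.WithBot.lt_zero_iff.1 h with h'; exact h')) hq0
    · exact absurd h hdeg
    · exact h
  obtain ⟨t, ht⟩ := Complex.exists_root hpos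
  have h := (hu.map (MvPolynomial.eval (fun _ : Fin 2 => t))).ne_zero
  apply h
  rw [mvEval_aeval_X]
  exact ht

/-- **Irreducibility descends**: if `q(X_i)` is irreducible in `ℂ[x₀, y₀]` then `q` is irreducible in
`ℂ[X]`. [folklore] -/
theorem irreducible_of_irreducible_aeval_X (q : Polynomial ℂ) (i : Fin 2)
    (h : Irreducible (Polynomial.aeval (X i : MvPolynomial (Fin 2) ℂ) q)) : Irreducible q := by
  refine ⟨fun hu => h.not_isUnit (hu.map _), fun a b hab => ?_⟩
  have hfac : Polynomial.aeval (X i : MvPolynomial (Fin 2) ℂ) q =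
      Polynomial.aeval (X i : MvPolynomial (Fin 2) ℂ) a * Polynomial.aeval (X i : MvPolynomial (Fin 2) ℂ) b := by
    rw [hab, map_mul]
  rcases h.isUnit_or_isUnit hfac with ha | hb
  · exact Or.inl (isUnit_of_isUnit_aeval_X a i ha)
  · exact Or.inr (isUnit_of_isUnit_aeval_X b i hb)

/-- **An irreducible `P ∈ ℂ[y₀] ⊆ ℂ[x₀, y₀]` has exactly one root**: there is `θ` with
`P(x, y) = 0 → y = θ`. [folklore] -/
theorem exists_root_eq_of_irreducible_univariate (hirr : Irreducible P) (h0 : ∀ v ∈ P.support, v 0 = 0) :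
    ∃ θ : ℂ, ∀ x y : ℂ, MvPolynomial.eval ![x, y] P = 0 → y = θ := by
  classical
  set q : Polynomial ℂ := ∑ v ∈ P.support, Polynomial.monomial (v 1) (P.coeff v) with hq
  have hPq := eq_aeval_X_one_of_forall P h0
  have hqirr : Irreducible q := irreducible_of_irreducible_aeval_X q 1 (hPq ▸ hirr)
  have hdeg : q.degree = 1 := IsAlgClosed.degree_eq_one_of_irreducible ℂ hqirr
  have hq1 : q.coeff 1 ≠ 0 := by
    have : q.natDegree = 1 := Polynomial.natDegree_eq_of_degree_eq_some hdeg
    rw [← this]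
    exact Polynomial.leadingCoeff_ne_zero.2 hqirr.ne_zero
  refine ⟨-q.coeff 0 / q.coeff 1, fun x y hxy => ?_⟩
  rw [hPq, mvEval_aeval_X, ← hq] at hxy
  have e := Polynomial.eq_X_add_C_of_degree_le_one hdeg.le
  have hy : q.eval y = 0 := by simpa using hxy
  rw [e] at hy
  simp only [Polynomial.eval_add, Polynomial.eval_mul, Polynomial.eval_C, Polynomial.eval_X] at hy
  field_simp
  linear_combination hy

end Univariate

/-! ## Part B. The residual theorem for multiplicatively free surfaces -/

section Free

variable (p : Polynomial ℂ)

/-- **Over polynomial graphs of degree `≥ 2`, a multiplicatively FREE surface of Mantova–Masser's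
case without Zariski-dense exponential points has a fibre curve of `y₀`-degree `≥ 2`** (with all of
gen 18's equimodular conditions).  Equivalently: Mantova–Masser's density question holds for every
multiplicatively free surface of the case over a polynomial graph whose fibre curve is `y₀`-linear.
[cite: MantovaMasser2023, §1 Further remarks, p. 5 (the question, open in general)] (new) -/
theorem mmCase_graphBase_residual_of_isMulFree (hd : 2 ≤ p.natDegree) {W : Set (Fin 2 ⊕ Fin 2 → ℂ)}
    (hmm : MMCaseDimPiOneFree W)
    (hbase : zeroLocus ℂ (vanishingIdeal ℂ (projAdd '' (W ∩ torusLocus ℂ 2))) =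
      {x : Fin 2 → ℂ | x 1 = p.eval (x 0)})
    (hfree : IsMulFree ℂ 2 W) (hnot : ¬ UnprojectedDense W) :
    ∃ P₂ : MvPolynomial (Fin 2) ℂ, Irreducible P₂ ∧
      (∃ v ∈ P₂.support, ∃ v' ∈ P₂.support, v 1 ≠ v' 1) ∧
      W = {w : Fin 2 ⊕ Fin 2 → ℂ | w (Sum.inl 1) = p.eval (w (Sum.inl 0)) ∧
        MvPolynomial.eval ![w (Sum.inl 0), w (Sum.inr 0)] P₂ = 0} ∧
      (p.leadingCoeff * I ^ p.natDegree).re = 0 ∧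
      (∀ v₀ ∈ P₂.support, (∀ v ∈ P₂.support, v 0 ≤ v₀ 0) →
        (∃ vR ∈ P₂.support, vR 0 = v₀ 0 ∧ ∀ u ∈ P₂.support, u 1 ≤ vR 1) ∧
        (∃ vL ∈ P₂.support, vL 0 = v₀ 0 ∧ ∀ u ∈ P₂.support, vL 1 ≤ u 1)) ∧
      (∀ N₀ : ℕ, (∀ v ∈ P₂.support, v 0 ≤ N₀) → ∀ va ∈ P₂.support, ∀ vc ∈ P₂.support,
        va 0 = N₀ → vc 0 = N₀ → va 1 ≠ vc 1 → ∀ θ : ℂ, θ ≠ 0 →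
        (∑ v ∈ P₂.support.filter (fun v : Fin 2 →₀ ℕ => v 0 = N₀),
          Polynomial.C (P₂.coeff v) * Polynomial.X ^ (v 1)).eval θ = 0 →
        (p.natDegree : ℝ) * (p.leadingCoeff * I ^ (p.natDegree - 1)).re * Real.log ‖θ‖ +
          (p.coeff (p.natDegree - 1) * I ^ (p.natDegree - 1)).re = 0) ∧
      ∃ v ∈ P₂.support, 2 ≤ v 1 := by
  obtain ⟨P₂, hirr₂, h1, hW₂, hre, hrow, hroot, halt⟩ :=
    mmCase_graphBase_residual_nonlinear p hd hmm hbase hnot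
  refine ⟨P₂, hirr₂, h1, hW₂, hre, hrow, hroot, ?_⟩
  rcases halt with h | h0
  · exact h
  · -- constant fibre `y₀ = θ`: the monomial `y₀` is constant on `W`, contradicting freeness
    exfalso
    obtain ⟨θ, hθ⟩ := exists_root_eq_of_irreducible_univariate P₂ hirr₂ h0
    refine hfree (Pi.single 0 1) ?_ ⟨θ, fun z hz => ?_⟩
    · intro h
      have := congrFun h 0
      simp at this
    · rw [hW₂] at hz
      obtain ⟨-, hz2⟩ := hz
      rw [Fin.prod_univ_two]
      simp only [Pi.single_eq_same, zpow_one, ne_eq, one_ne_zero, not_false_eq_true,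
        Pi.single_eq_of_ne, zpow_zero, mul_one]
      exact hθ _ _ hz2

end Free

end Summit.Schanuel.Schanuel.Theorems
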